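/-
line stmt-HodgeConjecture-18881 Cruxes/BlochSeedDiscOne/Lines/birth.lean 814a6a70c14e831a stub_rung_pad4_seedAt

# UnipotentEInfLaw — kernel shadow of the g15 memo `U-EINF-unipotent1-g15.md` (hsemireg-alphabet-unipotent-1, generation 15)

EVIDENCE ONLY. Nothing in this file is a rung, and nothing here is proved toward HC / HC_CM / HC_AV / №4 / 26512 / 18881 / H2.
It certifies the ARITHMETIC SKELETON of THEOREM E∞ of the memo: for every indecomposable finite-length module W over R = k⟦z,w⟧
with zW cyclic ≠ 0 (μ(zW) = 1) the U-PROD tier-(ii) inequality (QA♭) `2e − 4στ + 14α_z ≥ d − 2` holds — for ALL β_K (g14 had β_K ≤ 34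
by a finite certificate).  The pen proof (memo §1–§3) bounds Ψ := 2e − d + 14α_z − 4στ + 2 from below by a "level form"

  ΨB = 9σ + 2ν + β + 2 + (R − ν)(4σ − 2ν) + Σ_{i ≥ 2} (2 b_i² − 2 b_i p_{i+1}) + 13 Σ_{1 ≤ i < β} b_i − Σ_{i ≥ β} b_i − 2 b₁ (p₁ + p₂) + 15 Σ_{x ≥ 1} C(p_x, 2)

(b_i = number of k⟦w⟧-blocks of K = ker z longer than i, ν = n₁ = number of blocks of length 1, p = conjugate of the drop partition of zW,
R = σ + 1 − τ ≥ ν, and the normal-form cap b₂ ≥ b₁ − (p₁ + p₂) − 2), and shows ΨB > 0.  This file checks: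

* `tau_term_identity`  — the exact bookkeeping of the τ-terms: 2ντ + 2σ(σ−ν) + 2b₁² − 4στ = −4σ + 2ν + (R−ν)(4σ−2ν) when τ = 1+σ−R, b₁ = σ−ν;
* `level_short`        — a short level 2 ≤ i < β absorbs its cap cost:  b² ≤ 2b² + 13b + 15·C(p,2) − 2bp  (2·C(p,2) = p(p−1));
* `level_long`         — a long level i ≥ β is free: 0 ≤ 2b² − b;
* `q_sq_le`            — AM–GM for the two top conjugate parts: (p₁+p₂)² ≤ 4(C(p₁,2)+C(p₂,2)) + 2(p₁+p₂);
* `level_one_core`     — THE nonlinear step: with q := p₁+p₂, c := C(p₁,2)+C(p₂,2), the cap b₁ ≤ b₂ + q + 2 and q² ≤ 4c + 2q,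
                          0 < 9σ + 2ν + β + 2 + 13b₁ + 15c + b₂² − 2b₁q   (cases q ≤ 6 ∕ q ≥ 7 ∧ b₁ ≥ q+2 (negative discriminant) ∕ q ≥ 7 ∧ b₁ ≤ q+1);
* `einf_assembly`      — the assembly: level form ≥ (base + level-one core + nonnegative levels) > 0, as an implication between integers;
* `qa_flat_of_psi_pos` — Ψ > 0 ⇒ (QA♭);  `open_regime_after_EInf` — what is left of the open regime: 2 ≤ μ(zW) < 3τ∕14 forces τ ≥ 10;
* `thin_cell_beta30`, `cap_necessity_witness` — the two numerical anchors quoted in the memo (ΨB = 2056 at g14's β = 30 thin cell; ΨB = −78 < 0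
                          on a profile violating the cap, so `level_one_core`'s cap hypothesis is load-bearing).

The structural inputs (e = dim Hom(W∕zW, K) + ℓ(zW) exactly; H ≥ n₁τ + Σ_{|J|≥2}(K[|J|] − D[|J|]); α_z ≥ K[β] + ℓ(z²W); ℓ(z²W) ≥ Σ_x C(p_x,2);
τ = 1+σ−R with R ≥ n₁; n_{≤2} ≤ p₁+p₂+2) and the Abel summation turning the block form into the level form are pen statements in the memo, cross-checked
exactly by `g15/code/einf_cells.py` (1 803 097 cells, β ≤ 21, + 1 171 253 random profiles: identity block form = level form with 0 mismatches) and on actual modules by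
`g15/code/einf_modules.py` (e = H + r exact on all 5 811 modules built, 1 297 of them certified indecomposable).  Mathlib only; no `sorry`; no unsafe options; no banned `set_option` (the reducibility override is absent).
-/
import Mathlib

namespace HsemiregAlphabetUnipotent1.G15

/-! ## Bookkeeping identity for the τ-terms -/

/-- With τ = 1 + σ − R and b₁ = σ − ν:  2ντ + 2σ(σ−ν) + 2b₁² − 4στ = −4σ + 2ν + (R − ν)(4σ − 2ν). -/
theorem tau_term_identity (σ ν R τ b₁ : ℤ) (hτ : τ = 1 + σ - R) (hb : b₁ = σ - ν) :
    2 * ν * τ + 2 * σ * (σ - ν) + 2 * b₁ ^ 2 - 4 * σ * τ = -4 * σ + 2 * ν + (R - ν) * (4 * σ - 2 * ν) := by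
  subst hτ; subst hb; ring

/-- The τ-term is at least −4σ + 2ν when R ≥ ν and 2σ ≥ ν (ν = n₁ ≤ σ blocks). -/
theorem tau_term_lower (σ ν R : ℤ) (hR : ν ≤ R) (hνσ : ν ≤ σ) (hν : 0 ≤ ν) :
    -4 * σ + 2 * ν ≤ -4 * σ + 2 * ν + (R - ν) * (4 * σ - 2 * ν) := by
  nlinarith [mul_nonneg (show (0:ℤ) ≤ R - ν by linarith) (show (0:ℤ) ≤ 4 * σ - 2 * ν by linarith)]

/-! ## Level lemmas -/

/-- Short level (2 ≤ i < β): the cap cost 2·b·p is absorbed, leaving b².  Here `2c = p(p−1)`, i.e. c = C(p,2). -/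
theorem level_short (b p c : ℤ) (hb : 0 ≤ b) (hp : 0 ≤ p) (hc : 2 * c = p * (p - 1)) :
    b ^ 2 ≤ 2 * b ^ 2 + 13 * b + 15 * c - 2 * b * p := by
  by_cases h : p ≤ 1
  · -- p ∈ {0, 1}: c = 0 and 2bp ≤ 2b ≤ 13b
    have hc0 : 0 ≤ c := by nlinarith
    nlinarith [mul_nonneg hb (show (0:ℤ) ≤ 1 - p by linarith)]
  · -- p ≥ 2: 2bp ≤ b² + p² and 2p² ≤ 15p(p−1) ⟺ 15 ≤ 13p
    have h2 : 2 ≤ p := by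
      by_contra h'; exact h (by linarith)
    nlinarith [sq_nonneg (b - p), mul_nonneg (show (0:ℤ) ≤ p - 2 by linarith) hp]

/-- Long level (i ≥ β, where p_{i+1} = 0): 0 ≤ 2b² − b for an integer b ≥ 0. -/
theorem level_long (b : ℤ) (hb : 0 ≤ b) : 0 ≤ 2 * b ^ 2 - b := by
  rcases eq_or_lt_of_le hb with h | h
  · subst h; norm_num
  · nlinarith

/-- AM–GM for the two top conjugate parts: with q = p₁ + p₂ and c = C(p₁,2) + C(p₂,2) (so 2c = p₁(p₁−1) + p₂(p₂−1)),  q² ≤ 4c + 2q. -/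
theorem q_sq_le (p₁ p₂ c : ℤ) (hc : 2 * c = p₁ * (p₁ - 1) + p₂ * (p₂ - 1)) :
    (p₁ + p₂) ^ 2 ≤ 4 * c + 2 * (p₁ + p₂) := by
  nlinarith [sq_nonneg (p₁ - p₂)]

/-! ## The nonlinear step at level 1 -/

/-- LEVEL-ONE CORE.  σ ≥ 0 blocks, ν = n₁ ≥ 0, β ≥ 0, b₁ ≥ 0 blocks longer than 1, b₂ ≥ 0 blocks longer than 2, q = p₁+p₂ ≥ 0,
c = C(p₁,2)+C(p₂,2) ≥ 0 with q² ≤ 4c + 2q (`q_sq_le`; q ≥ 0 is not even needed), and the normal-form cap n_{≤2} ≤ q + 2, i.e. b₁ ≤ b₂ + q + 2 (b₁ − b₂ = n₂ ≤ n_{≤2}).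
Then the level-1 budget is positive. -/
theorem level_one_core (σ ν β b₁ b₂ q c : ℤ) (hσ : 0 ≤ σ) (hν : 0 ≤ ν) (hβ : 0 ≤ β) (hb₁ : 0 ≤ b₁) (hb₂ : 0 ≤ b₂)
    (hc : 0 ≤ c) (hq : q ^ 2 ≤ 4 * c + 2 * q) (hcap : b₁ ≤ b₂ + q + 2) :
    0 < 9 * σ + 2 * ν + β + 2 + 13 * b₁ + 15 * c + b₂ ^ 2 - 2 * b₁ * q := by
  by_cases h6 : q ≤ 6
  · -- q ≤ 6: 13b₁ − 2b₁q ≥ b₁ ≥ 0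
    nlinarith [mul_nonneg hb₁ (show (0:ℤ) ≤ 13 - 2 * q by linarith), sq_nonneg b₂]
  · have h7 : 7 ≤ q := by
      by_contra h'; exact h6 (by linarith)
    by_cases hbig : q + 2 ≤ b₁
    · -- b₁ ≥ q + 2: b₂ ≥ b₁ − q − 2 ≥ 0, so b₂² ≥ (b₁ − q − 2)²; then 4·(budget) ≥ 19q² − (16b₁+14)q + 4b₁² + 36b₁ + 24 + … has negative discriminant
      have hsq : (b₁ - q - 2) ^ 2 ≤ b₂ ^ 2 := by nlinarith
      nlinarith [sq_nonneg (19 * q - 8 * b₁ - 7), hsq, hq]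
    · -- b₁ ≤ q + 1 and q ≥ 7: b₁(2q − 13) ≤ (q+1)(2q−13)
      have hsmall : b₁ ≤ q + 1 := by
        by_contra h'; exact hbig (by linarith)
      nlinarith [mul_nonneg (show (0:ℤ) ≤ q + 1 - b₁ by linarith) (show (0:ℤ) ≤ 2 * q - 13 by linarith), hq, sq_nonneg b₂]

/-- The β = 1 edge (level 1 is then a long level; q = 1, no 13·b₁ term): 9σ + 2ν + 3 − 3b₁ > 0 since b₁ ≤ σ. -/
theorem level_one_beta_one (σ ν b₁ : ℤ) (hν : 0 ≤ ν) (hb : 0 ≤ b₁) (hbσ : b₁ ≤ σ) :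
    0 < 9 * σ + 2 * ν + 1 + 2 - b₁ - 2 * b₁ * 1 := by
  nlinarith

/-! ## Assembly (as an implication between the named integer aggregates)

`ΨB = base + T1 + Sshort + Slong + (R−ν)(4σ−2ν) + 15·c_rest` with
 base + T1 = 9σ + 2ν + β + 2 + 13b₁ + 15c − 2b₁q   (β ≥ 2),   Sshort = Σ_{2≤i<β} (2b_i² + 13b_i + 15C(p_{i+1},2) − 2b_ip_{i+1}) ≥ b₂² (`level_short`,
 keeping only i = 2 when β ≥ 3; Sshort = 0 and the b₂-level is long when β = 2),   Slong = Σ_{i≥β, i≥2} (2b_i² − b_i) ≥ 0 (`level_long`),   c_rest ≥ 0. -/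
theorem einf_assembly (σ ν β b₁ b₂ q c R Sshort Slong crest ΨB : ℤ)
    (hσ : 0 ≤ σ) (hν : 0 ≤ ν) (hβ : 2 ≤ β) (hb₁ : 0 ≤ b₁) (hb₂ : 0 ≤ b₂) (hc : 0 ≤ c)
    (hq : q ^ 2 ≤ 4 * c + 2 * q) (hcap : b₁ ≤ b₂ + q + 2) (hR : ν ≤ R) (hνσ : ν ≤ σ)
    (hshort : (if 3 ≤ β then b₂ ^ 2 else 0) ≤ Sshort) (hlong : (if 3 ≤ β then 0 else 2 * b₂ ^ 2 - b₂) ≤ Slong) (hrest : 0 ≤ crest)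
    (hΨ : ΨB = 9 * σ + 2 * ν + β + 2 + (R - ν) * (4 * σ - 2 * ν) + 13 * b₁ + 15 * c - 2 * b₁ * q + Sshort + Slong + 15 * crest) :
    0 < ΨB := by
  have hRν : 0 ≤ (R - ν) * (4 * σ - 2 * ν) :=
    mul_nonneg (by linarith) (by linarith)
  by_cases h3 : 3 ≤ β
  · rw [if_pos h3] at hshort; rw [if_pos h3] at hlong
    have := level_one_core σ ν β b₁ b₂ q c hσ hν (by linarith) hb₁ hb₂ hc hq hcap
    linarith
  · rw [if_neg h3] at hshort; rw [if_neg h3] at hlong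
    -- β = 2: q = p₁ + p₂ ≤ β = 2 is all we need besides b₂-level long; we do not even need the cap: 13b₁ − 2b₁q ≥ 9b₁ when q ≤ 2.
    -- (q ≤ β always: p₁ + p₂ = D[2] ≤ β.)  We prove it from the level-one core with b₂-square supplied by the long level.
    have hl : 0 ≤ 2 * b₂ ^ 2 - b₂ := level_long b₂ hb₂
    have := level_one_core σ ν β b₁ b₂ q c hσ hν (by linarith) hb₁ hb₂ hc hq hcap
    nlinarith

/-! ## Consequences -/

/-- Ψ > 0 is (QA♭) with one unit to spare: from 0 < 2e − d + 14α − 4στ + 2 get d − 2 ≤ 2e − 4στ + 14α (indeed d − 1 ≤ …). -/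
theorem qa_flat_of_psi_pos (d e α σ τ : ℤ) (h : 0 < 2 * e - d + 14 * α - 4 * σ * τ + 2) :
    d - 2 ≤ 2 * e - 4 * σ * τ + 14 * α := by
  linarith

/-- What remains of the open regime of (A♭)/(QA♭) after THEOREM E∞: 1 ≤ μ(zW), 14μ < 3τ and μ ≠ 1 force 2 ≤ μ and 10 ≤ τ. -/
theorem open_regime_after_EInf (τ μ : ℕ) (h1 : 1 ≤ μ) (h2 : 14 * μ < 3 * τ) (h3 : μ ≠ 1) : 2 ≤ μ ∧ 10 ≤ τ := by
  omega

/-! ## Numerical anchors quoted in the memo -/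

/-- g14's β = 30 thin cell (d = (5,4,4,3,3,2,2,2,1,1,1,1,1), p = (13,8,5,3,1), σ = 36, R = ν = n₁ = 6, τ = 31, b = (36; 30,16,7,3,1), lz = 119):
level form = 9·36 + 12 + 30 + 2 + 0 + 2(16²+7²+3²+1²) + 13(30+16+7+3+1) − 0 + 15·119 − 2·30·21 − 2(16·5 + 7·3 + 3·1) = 2056
(= g14's exact Ψ_cert at that cell: the E∞ relaxation loses nothing there). -/
theorem thin_cell_beta30 :
    (9 * 36 + 2 * 6 + 30 + 2 + (6 - 6) * (4 * 36 - 2 * 6) + 2 * (16 ^ 2 + 7 ^ 2 + 3 ^ 2 + 1 ^ 2)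
      + 13 * (30 + 16 + 7 + 3 + 1) - 0 + 15 * 119 - 2 * 30 * (13 + 8) - 2 * (16 * 5 + 7 * 3 + 3 * 1) : ℤ) = 2056 := by
  norm_num

/-- The cap is load-bearing: σ = 124 blocks all of length 2 (ν = 0, b₁ = 124, b₂ = 0), drops d = (2²⁷) (β = 54, p₁ = p₂ = 27, q = 54,
Σ C(p_x,2) = 2·C(27,2) = 702), R = 0 (τ = 125) — a profile violating n_{≤2} ≤ q + 2 — has level form
9·124 + 0 + 54 + 2 + 0 + 0 + 13·124 − 0 − 2·124·54 − 0 + 15·702 = −78 < 0. -/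
theorem cap_necessity_witness :
    (9 * 124 + 0 + 54 + 2 + 0 + 0 + 13 * 124 - 0 - 2 * 124 * 54 - 0 + 15 * 702 : ℤ) = -78 ∧ ¬ ((124 : ℤ) ≤ 0 + 54 + 2) := by
  norm_num

end HsemiregAlphabetUnipotent1.G15
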